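import Summits.ResolutionOfSingularities.ResolutionOfSingularities.Theorems.PurelyInseparableDim4ChartAtlasSNCFarRepairTranslated
import Literature.AlgebraicGeometry.Resolution.StrictTransformDistinct
import HarnessLib

/-!
# Purely inseparable four-folds `z^p + F(x₁, …, x₄)`: THE OLD BOUNDARY MEMBERS AFTER THE FAR-RESONANCE REPAIR, read on the chart of
# the repaired centre (chart model, natural frame, one height; cell `res-dim4-pi`, typ-2 g8; HANDOFF g7 OPEN 4 «R2 p707037 transported»)

[OURS · counted 0] (D-0157 DOOR 2; DR-157-C.) Companion of `…SNCFarRepairReading` (the reading of the escaping centre / state / exceptional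
component after the repair). Setting: the `x_j`-chart model of an escaping step in its NATURAL frame (p704073 / p720339 §1: the transformed
boundary reads `⊤`, hyperplanes `(y_m + a)·𝒪`, and far quadrics `((y_k + β)·y_j − 0·y_k + d)·𝒪`, `k ≠ j`), escaping centre `V(y_0, y_T)`
(`j ∉ T`), ONE resonance height `h`, repair centre `C_h = ψ_{−h}^*𝓘(V(y_0, y_T, y_j))`, `τ` ANY blowing up of `𝔸⁵` along `C_h`; the chart is
the `y_j`-chart of `τ ≫ ψ_{−h}` (a blowing up along `V(y_0, y_T, y_j)`, p717520), possibly behind a cleaning automorphism `Θ` (`z ↦ z + g(y)`,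
`yᵢ ↦ yᵢ`), which fixes every member (members live in `K[y]`). PROVED here (no `sorry`, no new axiom) — R2's dictionary (p707037, frame
`c′ = −h`) pulled back along the translation `ψ_h` (p717520 `strictTransformIdeal_comp_base`):

* `comap_specMap_principal_of_fix` — a principal member fixed by `Θ` reads the same behind `Spec Θ`;
* `strictTransform_top_height` — `⊤ ↦ ⊤`;
* `strictTransform_hyperplane_j_height_self` / `_of_ne` — the index-`j` hyperplane `(y_j + a)`: DIES (`⊤`) if it is AT the height (`a + h = 0`),
  else reads `(y_j + (a + h))·𝒪` (translated, still transversal to `V(y_0, y_T)`);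
* `strictTransform_hyperplane_centreVar_height` — a near member `y_t·𝒪`, `t ∈ T` (through the centre): reads `y_t·𝒪`;
* `strictTransform_hyperplane_centreVar_height_of_ne` — `(y_t + a)·𝒪`, `t ∈ T`, `a ≠ 0` (misses the centre): reads the product quadric
  `(y_j·y_t + a)·𝒪`, which MISSES `V(y_0, y_T)` (`disjoint_support_productQuadric_CΛ`);
* `strictTransform_hyperplane_transversal_height` — `(yᵢ + a)·𝒪`, `i ∉ T`, `i ≠ j`: reads itself;
* `strictTransform_farQuadric_resonant_height` — a RESONANT far quadric (`k ∈ T`, `d + β·h = 0`, `β ≠ 0`) reads `(y_k·(y_j − (−h)) + β)·𝒪`,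
  which MISSES `V(y_0, y_T)` (`disjoint_support_resonantReading_CΛ`) — the resonance is gone;
* `strictTransform_farQuadric_nonresonant_height` — a NON-resonant active far quadric (`k ∈ T`, `d + β·h ≠ 0`) reads the CUBIC
  `((y_j·y_k + β)·y_j − (−h)·y_j·y_k + (d + β·h))·𝒪` (meets `V(y_0, y_T)` at its shifted height);
* `strictTransform_farQuadric_inactive_height` — a far quadric of index `k ∉ T` (`k ≠ j`, `h ≠ 0`) reads the translated quadric
  `((y_k + β)·y_j − (−h)·y_k + (d + β·h))·𝒪`.

The output shapes are LITERALLY those of R3 p708112 (`hasSNCWith_𝓘Λ_of_forall_mem_after_farRepair`, frame `c′ = −h`): hyperplanes, product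
quadrics `y_j·y_m + a`, `y_k·(y_j − c′) + b_k`, cubics, translated quadrics — so the chart theorems of the far repair apply on the new chart verbatim.

Nothing here is a statement about resolution of singularities in dimension ≥ 4 / characteristic `p` (NOT proved anywhere in this programme).
bears_on: LADDER-RESOLUTION:D157-DOOR2 (res-dim4-pi). Supports stmt-ResolutionOfSingularities-16155 (helper).
-/

-- every declaration of this summit lives under `Summit.ResolutionOfSingularities.ResolutionOfSingularities`
-- (summit = problem), which the duplicate-namespace linter flags; house convention (cf. the Target file).
set_option linter.dupNamespace false

noncomputable section

open MvPolynomial CategoryTheory AlgebraicGeometry TopologicalSpace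
open AlgebraicGeometry.Scheme.IdealSheafData (ofIdealTop)

namespace Summit.ResolutionOfSingularities.ResolutionOfSingularities.Theorems.PIDim4

open Literature.AlgebraicGeometry.Resolution
open Literature.AlgebraicGeometry.Resolution.AffinePointBlowup (P A γ coord)
open Literature.AlgebraicGeometry.Hironaka2017.SpecOrders

namespace ChartDictionary

variable {K : Type} [Field K] {T : Finset (Fin 4)} {j : Fin 4} {V' : Scheme.{0}} {τ : V' ⟶ P 4 K} {h : K}

/-! ## §1 Bookkeeping: behind a cleaning automorphism; along the translation -/

/-- A principal member fixed by a ring automorphism `Θ` reads the same behind `Spec Θ`. -/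
theorem comap_specMap_principal_of_fix (Θ : A 4 K ≃ₐ[K] A 4 K) {q : A 4 K} (hq : Θ q = q) :
    (ofIdealTop (Ideal.span {(γ 4 K).symm q})).comap (Spec.map (CommRingCat.ofHom (Θ : A 4 K →+* A 4 K))) =
      ofIdealTop (Ideal.span {(γ 4 K).symm q}) := by
  rw [comap_ofIdealTop_span_γ_symm, RingHom.coe_coe, hq]

/-- `⊤` is fixed behind any morphism. -/
theorem comap_top_specMap (Θ : A 4 K ≃ₐ[K] A 4 K) :
    (⊤ : Scheme.IdealSheafData (P 4 K)).comap (Spec.map (CommRingCat.ofHom (Θ : A 4 K →+* A 4 K))) = ⊤ :=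
  Scheme.IdealSheafData.comap_top _

section Height

/-- Strict transforms along `τ` (centre `C_h`) of a principal member are strict transforms along `τ ≫ ψ_{−h}` (centre `V(y_0, y_T, y_j)`) of the
translated member `ψ_h^*(q·𝒪) = (θ_h q)·𝒪`. -/
theorem strictTransformIdeal_height_principal (h : K) (q : A 4 K) :
    strictTransformIdeal τ ((AffineCoordBlowup.𝓘Λ 4 K (insert 0 (Fin.succ '' ((insert j T : Finset (Fin 4)) : Set (Fin 4))))).comap
        (Spec.map (CommRingCat.ofHom ((AffinePointBlowup.translateEquiv (n := 4) (Pi.single j.succ (-h)) : A 4 K ≃ₐ[K] A 4 K) :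
          A 4 K →+* A 4 K)))) (ofIdealTop (Ideal.span {(γ 4 K).symm q})) =
      strictTransformIdeal (τ ≫ Spec.map (CommRingCat.ofHom ((AffinePointBlowup.translateEquiv (n := 4) (Pi.single j.succ (-h)) :
          A 4 K ≃ₐ[K] A 4 K) : A 4 K →+* A 4 K)))
        (AffineCoordBlowup.𝓘Λ 4 K (insert 0 (Fin.succ '' ((insert j T : Finset (Fin 4)) : Set (Fin 4)))))
        (ofIdealTop (Ideal.span {(γ 4 K).symm (AffinePointBlowup.translateEquiv (n := 4) (Pi.single j.succ h) q)})) := by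
  have hc := spec_translate_single_comp (K := K) (j := j) (-h)
  rw [neg_neg] at hc
  have e1 : ofIdealTop (Ideal.span {(γ 4 K).symm (AffinePointBlowup.translateEquiv (n := 4) (Pi.single j.succ h) q)}) =
      (ofIdealTop (Ideal.span {(γ 4 K).symm q})).comap (Spec.map (CommRingCat.ofHom
        ((AffinePointBlowup.translateEquiv (n := 4) (Pi.single j.succ h) : A 4 K ≃ₐ[K] A 4 K) : A 4 K →+* A 4 K))) := by
    rw [comap_ofIdealTop_span_γ_symm, RingHom.coe_coe]
  rw [strictTransformIdeal_comp_base, e1, ← Scheme.IdealSheafData.comap_comp, hc, Scheme.IdealSheafData.comap_id]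

/-- `θ_h (y_j) = y_j + h`, `θ_h (y_m) = y_m` for `m ≠ j⁺`, `θ_h (C a) = C a`. -/
theorem translateEquiv_single_X_self (h : K) :
    AffinePointBlowup.translateEquiv (n := 4) (Pi.single j.succ h) (X j.succ : A 4 K) = X j.succ + C h := by
  rw [AffinePointBlowup.translateEquiv_X, Pi.single_eq_same]

/-- See `translateEquiv_single_X_self`. -/
theorem translateEquiv_single_X_of_ne (h : K) {m : Fin (4 + 1)} (hm : m ≠ j.succ) :
    AffinePointBlowup.translateEquiv (n := 4) (Pi.single j.succ h) (X m : A 4 K) = X m := by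
  rw [AffinePointBlowup.translateEquiv_X, Pi.single_eq_of_ne hm, C_0, add_zero]

/-- The far quadric in the natural frame, translated to the height: `θ_h(((y_k + β)·y_j − 0·y_k + d)) = (y_k + β)·y_j − (−h)·y_k + (d + β·h)`
(the shape of R2 p707037 with `c′ = −h`, `e = d + β·h`). -/
theorem translateEquiv_single_farQuadric (h : K) {k : Fin 4} (hkj : k ≠ j) (β d : K) :
    AffinePointBlowup.translateEquiv (n := 4) (Pi.single j.succ h) ((X k.succ + C β) * X j.succ - C (0 : K) * X k.succ + C d : A 4 K) =
      (X k.succ + C β) * X j.succ - C (-h) * X k.succ + C (d + β * h) := by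
  have hC : ∀ a : K, AffinePointBlowup.translateEquiv (n := 4) (Pi.single j.succ h) (C a : A 4 K) = C a :=
    fun a => (AffinePointBlowup.translateEquiv _).commutes a
  have hk : AffinePointBlowup.translateEquiv (n := 4) (Pi.single j.succ h) (X k.succ : A 4 K) = X k.succ :=
    translateEquiv_single_X_of_ne h (fun e => hkj (Fin.succ_injective _ e))
  simp only [map_add, map_sub, map_mul, hC, hk, translateEquiv_single_X_self, map_neg, map_zero]
  ring

/-- **The product quadric `(y_j·y_t + a)·𝒪`, `t ∈ T`, `a ≠ 0`, misses `V(y_0, y_T)`** (on `V(y_T)` it is the unit `a`). -/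
theorem disjoint_support_productQuadric_CΛ {t : Fin 4} (ht : t ∈ T) {a : K} (ha : a ≠ 0) :
    Disjoint ((ofIdealTop (Ideal.span {(γ 4 K).symm (X j.succ * X t.succ + C a)})).support : Set (P 4 K))
      (AffineCoordBlowup.CΛ 4 K (insert 0 (Fin.succ '' (T : Set (Fin 4)))) : Set (P 4 K)) := by
  rw [Set.disjoint_left]
  intro y hy hyC
  rw [SetLike.mem_coe, ofIdealTop_span_γ_symm_eq_shf, mem_support_shf_iff, Ideal.span_singleton_le_iff_mem] at hy
  have hXt : (X t.succ : A 4 K) ∈ y.asIdeal := (AffineCoordBlowup.mem_CΛ_iff' 4 K _ y).mp hyC _ (succ_mem_centreVars ht)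
  have ha' : (C a : A 4 K) ∈ y.asIdeal := by
    have h1 := y.asIdeal.sub_mem hy (y.asIdeal.mul_mem_left (X j.succ) hXt)
    rwa [add_sub_cancel_left] at h1
  exact ha ((C_mem_asIdeal_iff y _).mp ha')

/-- **… and the reading misses `V(y_0, y_T)`** (R2 `disjoint_support_resonant_strictTransform_CΛ`, constants in place of functions). -/
theorem disjoint_support_resonantReading_CΛ {k : Fin 4} (hkT : k ∈ T) {β : K} (hβ : β ≠ 0) (h : K) :
    Disjoint ((ofIdealTop (Ideal.span {(γ 4 K).symm (X k.succ * (X j.succ - C (-h)) + C β)})).support : Set (P 4 K))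
      (AffineCoordBlowup.CΛ 4 K (insert 0 (Fin.succ '' (T : Set (Fin 4)))) : Set (P 4 K)) :=
  disjoint_support_resonant_strictTransform_CΛ (K := K) (j := j) (b := fun _ => β) (c' := -h) hkT hβ

end Height

/-! ## §2 The members, one by one -/

section Members

variable (hτ : IsBlowup τ ((AffineCoordBlowup.𝓘Λ 4 K (insert 0 (Fin.succ '' ((insert j T : Finset (Fin 4)) : Set (Fin 4))))).comap
  (Spec.map (CommRingCat.ofHom ((AffinePointBlowup.translateEquiv (n := 4) (Pi.single j.succ (-h)) : A 4 K ≃ₐ[K] A 4 K) :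
    A 4 K →+* A 4 K)))))

/-- **`⊤ ↦ ⊤`.** -/
theorem strictTransform_top_height :
    strictTransformIdeal τ ((AffineCoordBlowup.𝓘Λ 4 K (insert 0 (Fin.succ '' ((insert j T : Finset (Fin 4)) : Set (Fin 4))))).comap
      (Spec.map (CommRingCat.ofHom ((AffinePointBlowup.translateEquiv (n := 4) (Pi.single j.succ (-h)) : A 4 K ≃ₐ[K] A 4 K) :
        A 4 K →+* A 4 K)))) ⊤ = ⊤ :=
  strictTransformIdeal_top _ _

include hτ

/-- **The index-`j` hyperplane AT the height dies**: `(y_j + a)·𝒪` with `a + h = 0` (it is `y_j = h`, which contains the repair centre) reads `⊤` on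
the chart. -/
theorem strictTransform_hyperplane_j_height_self {a : K} (ha : a + h = 0) :
    (strictTransformIdeal τ ((AffineCoordBlowup.𝓘Λ 4 K (insert 0 (Fin.succ '' ((insert j T : Finset (Fin 4)) : Set (Fin 4))))).comap
        (Spec.map (CommRingCat.ofHom ((AffinePointBlowup.translateEquiv (n := 4) (Pi.single j.succ (-h)) : A 4 K ≃ₐ[K] A 4 K) :
          A 4 K →+* A 4 K)))) (ofIdealTop (Ideal.span {(γ 4 K).symm (X j.succ + C a)}))).comap
        (AffineCoordBlowup.chartImm (isBlowup_comp_spec_translate hτ) (succ_mem_centreVars (Finset.mem_insert_self j T))) = ⊤ := by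
  have ha' : h + a = 0 := by rw [add_comm]; exact ha
  have hC : AffinePointBlowup.translateEquiv (n := 4) (Pi.single j.succ h) (C a : A 4 K) = C a := (AffinePointBlowup.translateEquiv _).commutes a
  rw [strictTransformIdeal_height_principal, map_add, translateEquiv_single_X_self, hC, add_assoc, ← C_add, ha', C_0, add_zero]
  exact strictTransformIdeal_hyperplane_self_comap_chartImm (Finset.mem_insert_self j T) (isBlowup_comp_spec_translate hτ)

/-- **The index-`j` hyperplane OFF the height is translated**: `(y_j + a)·𝒪` with `a + h ≠ 0` reads `(y_j + (a + h))·𝒪`. -/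
theorem strictTransform_hyperplane_j_height_of_ne {a : K} (ha : a + h ≠ 0) :
    (strictTransformIdeal τ ((AffineCoordBlowup.𝓘Λ 4 K (insert 0 (Fin.succ '' ((insert j T : Finset (Fin 4)) : Set (Fin 4))))).comap
        (Spec.map (CommRingCat.ofHom ((AffinePointBlowup.translateEquiv (n := 4) (Pi.single j.succ (-h)) : A 4 K ≃ₐ[K] A 4 K) :
          A 4 K →+* A 4 K)))) (ofIdealTop (Ideal.span {(γ 4 K).symm (X j.succ + C a)}))).comap
        (AffineCoordBlowup.chartImm (isBlowup_comp_spec_translate hτ) (succ_mem_centreVars (Finset.mem_insert_self j T))) =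
      ofIdealTop (Ideal.span {(γ 4 K).symm (X j.succ + C (a + h))}) := by
  classical
  have hC : AffinePointBlowup.translateEquiv (n := 4) (Pi.single j.succ h) (C a : A 4 K) = C a := (AffinePointBlowup.translateEquiv _).commutes a
  have e1 : AffinePointBlowup.translateEquiv (n := 4) (Pi.single j.succ h) (X j.succ + C a : A 4 K) = X j.succ + C (a + h) := by
    rw [map_add, translateEquiv_single_X_self, hC, add_assoc, ← C_add, add_comm h]
  have e2 : coordBlowupSubst K (insert 0 (Fin.succ '' ((insert j T : Finset (Fin 4)) : Set (Fin 4)))) j.succ (X j.succ + C (a + h) : A 4 K) =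
      X j.succ + C (a + h) := by
    rw [map_add, coordBlowupSubst_X_self, coordBlowupSubst_C]
  rw [strictTransformIdeal_height_principal, e1,
    strictTransformIdeal_comap_chartImm_of_constantCoeff_ne_zero (Finset.mem_insert_self j T) ?_ (isBlowup_comp_spec_translate hτ), e2]
  simp only [map_add, constantCoeff_X, constantCoeff_C, zero_add]
  exact ha

/-- **A near member through the centre stays a coordinate hyperplane**: `y_t·𝒪`, `t ∈ T`, reads `y_t·𝒪` (written `(y_t + 0)·𝒪`). -/
theorem strictTransform_hyperplane_centreVar_height {t : Fin 4} (ht : t ∈ T) (hjT : j ∉ T) :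
    (strictTransformIdeal τ ((AffineCoordBlowup.𝓘Λ 4 K (insert 0 (Fin.succ '' ((insert j T : Finset (Fin 4)) : Set (Fin 4))))).comap
        (Spec.map (CommRingCat.ofHom ((AffinePointBlowup.translateEquiv (n := 4) (Pi.single j.succ (-h)) : A 4 K ≃ₐ[K] A 4 K) :
          A 4 K →+* A 4 K)))) (ofIdealTop (Ideal.span {(γ 4 K).symm (X t.succ + C 0)}))).comap
        (AffineCoordBlowup.chartImm (isBlowup_comp_spec_translate hτ) (succ_mem_centreVars (Finset.mem_insert_self j T))) =
      ofIdealTop (Ideal.span {(γ 4 K).symm (X t.succ + C 0)}) := by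
  have htj : t ≠ j := ne_of_mem_of_not_mem ht hjT
  rw [strictTransformIdeal_height_principal, C_0, add_zero, translateEquiv_single_X_of_ne h (fun e => htj (Fin.succ_injective _ e))]
  exact strictTransformIdeal_hyperplane_comap_chartImm (Finset.mem_insert_self j T) htj (isBlowup_comp_spec_translate hτ)

/-- **A near member of a centre index missing the centre becomes a product quadric**: `(y_t + a)·𝒪`, `t ∈ T`, `a ≠ 0`, reads `(y_t·y_j + a)·𝒪`. -/
theorem strictTransform_hyperplane_centreVar_height_of_ne {t : Fin 4} (ht : t ∈ T) (hjT : j ∉ T) {a : K} (ha : a ≠ 0) :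
    (strictTransformIdeal τ ((AffineCoordBlowup.𝓘Λ 4 K (insert 0 (Fin.succ '' ((insert j T : Finset (Fin 4)) : Set (Fin 4))))).comap
        (Spec.map (CommRingCat.ofHom ((AffinePointBlowup.translateEquiv (n := 4) (Pi.single j.succ (-h)) : A 4 K ≃ₐ[K] A 4 K) :
          A 4 K →+* A 4 K)))) (ofIdealTop (Ideal.span {(γ 4 K).symm (X t.succ + C a)}))).comap
        (AffineCoordBlowup.chartImm (isBlowup_comp_spec_translate hτ) (succ_mem_centreVars (Finset.mem_insert_self j T))) =
      ofIdealTop (Ideal.span {(γ 4 K).symm (X j.succ * X t.succ + C a)}) := by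
  classical
  have htj : t ≠ j := ne_of_mem_of_not_mem ht hjT
  have hC : AffinePointBlowup.translateEquiv (n := 4) (Pi.single j.succ h) (C a : A 4 K) = C a := (AffinePointBlowup.translateEquiv _).commutes a
  have e2 : coordBlowupSubst K (insert 0 (Fin.succ '' ((insert j T : Finset (Fin 4)) : Set (Fin 4)))) j.succ (X t.succ + C a : A 4 K) =
      X j.succ * X t.succ + C a := by
    rw [map_add, coordBlowupSubst_C,
      coordBlowupSubst_X_of_mem_of_ne K _ j.succ (succ_mem_centreVars (Finset.mem_insert_of_mem ht)) (fun e => htj (Fin.succ_injective _ e))]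
  rw [strictTransformIdeal_height_principal, map_add, translateEquiv_single_X_of_ne h (fun e => htj (Fin.succ_injective _ e)), hC,
    strictTransformIdeal_comap_chartImm_of_constantCoeff_ne_zero (Finset.mem_insert_self j T) ?_ (isBlowup_comp_spec_translate hτ), e2]
  simp only [map_add, constantCoeff_X, constantCoeff_C, zero_add]
  exact ha

/-- **A transversal member is unchanged**: `(yᵢ + a)·𝒪`, `i ∉ T`, `i ≠ j`, reads `(yᵢ + a)·𝒪`. -/
theorem strictTransform_hyperplane_transversal_height {i : Fin 4} (hiT : i ∉ T) (hij : i ≠ j) (a : K) :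
    (strictTransformIdeal τ ((AffineCoordBlowup.𝓘Λ 4 K (insert 0 (Fin.succ '' ((insert j T : Finset (Fin 4)) : Set (Fin 4))))).comap
        (Spec.map (CommRingCat.ofHom ((AffinePointBlowup.translateEquiv (n := 4) (Pi.single j.succ (-h)) : A 4 K ≃ₐ[K] A 4 K) :
          A 4 K →+* A 4 K)))) (ofIdealTop (Ideal.span {(γ 4 K).symm (X i.succ + C a)}))).comap
        (AffineCoordBlowup.chartImm (isBlowup_comp_spec_translate hτ) (succ_mem_centreVars (Finset.mem_insert_self j T))) =
      ofIdealTop (Ideal.span {(γ 4 K).symm (X i.succ + C a)}) := by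
  have hi : i ∉ insert j T := fun hi => by
    rcases Finset.mem_insert.mp hi with e | e
    · exact hij e
    · exact hiT e
  have hC : AffinePointBlowup.translateEquiv (n := 4) (Pi.single j.succ h) (C a : A 4 K) = C a := (AffinePointBlowup.translateEquiv _).commutes a
  rw [strictTransformIdeal_height_principal, map_add, translateEquiv_single_X_of_ne h (fun e => hij (Fin.succ_injective _ e)), hC]
  exact strictTransformIdeal_translate_comap_chartImm (Finset.mem_insert_self j T) hi a (isBlowup_comp_spec_translate hτ)

/-- **A RESONANT far quadric leaves the centre**: `((y_k + β)·y_j − 0·y_k + d)·𝒪` with `k ∈ T`, `β ≠ 0`, `d + β·h = 0` reads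
`(y_k·(y_j + h) + β)·𝒪` (R2 `comap_chartImm_strictTransform_resonant_after_farRepair` at `c′ = −h`). -/
theorem strictTransform_farQuadric_resonant_height (hjT : j ∉ T) {k : Fin 4} (hkT : k ∈ T) {β d : K} (hβ : β ≠ 0) (hres : d + β * h = 0) :
    (strictTransformIdeal τ ((AffineCoordBlowup.𝓘Λ 4 K (insert 0 (Fin.succ '' ((insert j T : Finset (Fin 4)) : Set (Fin 4))))).comap
        (Spec.map (CommRingCat.ofHom ((AffinePointBlowup.translateEquiv (n := 4) (Pi.single j.succ (-h)) : A 4 K ≃ₐ[K] A 4 K) :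
          A 4 K →+* A 4 K)))) (ofIdealTop (Ideal.span {(γ 4 K).symm ((X k.succ + C β) * X j.succ - C (0 : K) * X k.succ + C d)}))).comap
        (AffineCoordBlowup.chartImm (isBlowup_comp_spec_translate hτ) (succ_mem_centreVars (Finset.mem_insert_self j T))) =
      ofIdealTop (Ideal.span {(γ 4 K).symm (X k.succ * (X j.succ - C (-h)) + C β)}) := by
  have hkj : k ≠ j := ne_of_mem_of_not_mem hkT hjT
  rw [strictTransformIdeal_height_principal, translateEquiv_single_farQuadric h hkj, hres]
  exact comap_chartImm_strictTransform_resonant_after_farRepair (b := fun _ => β) (c' := -h) hjT hkT hβ (isBlowup_comp_spec_translate hτ)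

/-- **A NON-resonant active far quadric becomes a cubic**: `((y_k + β)·y_j − 0·y_k + d)·𝒪` with `k ∈ T`, `d + β·h ≠ 0` reads
`((y_j·y_k + β)·y_j − (−h)·(y_j·y_k) + (d + β·h))·𝒪` (R2 `comap_chartImm_strictTransform_nonresonant_after_farRepair`). -/
theorem strictTransform_farQuadric_nonresonant_height (hjT : j ∉ T) {k : Fin 4} (hkT : k ∈ T) (β : K) {d : K} (hne : d + β * h ≠ 0) :
    (strictTransformIdeal τ ((AffineCoordBlowup.𝓘Λ 4 K (insert 0 (Fin.succ '' ((insert j T : Finset (Fin 4)) : Set (Fin 4))))).comap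
        (Spec.map (CommRingCat.ofHom ((AffinePointBlowup.translateEquiv (n := 4) (Pi.single j.succ (-h)) : A 4 K ≃ₐ[K] A 4 K) :
          A 4 K →+* A 4 K)))) (ofIdealTop (Ideal.span {(γ 4 K).symm ((X k.succ + C β) * X j.succ - C (0 : K) * X k.succ + C d)}))).comap
        (AffineCoordBlowup.chartImm (isBlowup_comp_spec_translate hτ) (succ_mem_centreVars (Finset.mem_insert_self j T))) =
      ofIdealTop (Ideal.span {(γ 4 K).symm ((X j.succ * X k.succ + C β) * X j.succ - C (-h) * (X j.succ * X k.succ) + C (d + β * h))}) := by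
  have hkj : k ≠ j := ne_of_mem_of_not_mem hkT hjT
  rw [strictTransformIdeal_height_principal, translateEquiv_single_farQuadric h hkj]
  exact comap_chartImm_strictTransform_nonresonant_after_farRepair (b := fun _ => β) (e := fun _ => d + β * h) (c' := -h) hjT hkT hne
    (isBlowup_comp_spec_translate hτ)

/-- **A far quadric of a non-centre index keeps its (translated) shape**: `((y_k + β)·y_j − 0·y_k + d)·𝒪` with `k ∉ T`, `k ≠ j`, `h ≠ 0` reads
`((y_k + β)·y_j − (−h)·y_k + (d + β·h))·𝒪` (its total transform; `y_j ∤` it because of the monomial `h·y_k`). -/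
theorem strictTransform_farQuadric_inactive_height {k : Fin 4} (hkT : k ∉ T) (hkj : k ≠ j) (hh : h ≠ 0) (β d : K) :
    (strictTransformIdeal τ ((AffineCoordBlowup.𝓘Λ 4 K (insert 0 (Fin.succ '' ((insert j T : Finset (Fin 4)) : Set (Fin 4))))).comap
        (Spec.map (CommRingCat.ofHom ((AffinePointBlowup.translateEquiv (n := 4) (Pi.single j.succ (-h)) : A 4 K ≃ₐ[K] A 4 K) :
          A 4 K →+* A 4 K)))) (ofIdealTop (Ideal.span {(γ 4 K).symm ((X k.succ + C β) * X j.succ - C (0 : K) * X k.succ + C d)}))).comap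
        (AffineCoordBlowup.chartImm (isBlowup_comp_spec_translate hτ) (succ_mem_centreVars (Finset.mem_insert_self j T))) =
      ofIdealTop (Ideal.span {(γ 4 K).symm ((X k.succ + C β) * X j.succ - C (-h) * X k.succ + C (d + β * h))}) := by
  classical
  have hk : k ∉ insert j T := fun hk => by
    rcases Finset.mem_insert.mp hk with e | e
    · exact hkj e
    · exact hkT e
  rw [strictTransformIdeal_height_principal, translateEquiv_single_farQuadric h hkj]
  refine strictTransformIdeal_principal_comap_chartImm (Finset.mem_insert_self j T) 0 ?_ ?_ (isBlowup_comp_spec_translate hτ)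
  · have hkΛ : coordBlowupSubst K (insert 0 (Fin.succ '' ((insert j T : Finset (Fin 4)) : Set (Fin 4)))) j.succ (X k.succ : A 4 K) = X k.succ :=
      coordBlowupSubst_X_of_not_mem K _ j.succ (fun e => hk ((succ_mem_centreVars_iff _ k).mp e))
    rw [pow_zero, one_mul]
    simp only [map_add, map_sub, map_mul, coordBlowupSubst_C, coordBlowupSubst_X_self, hkΛ]
  · -- `y_j ∤`: the monomial `y_k` has coefficient `h ≠ 0`
    refine not_coord_dvd_γ_symm_of_coeff (Finsupp.single k.succ 1) (Finsupp.single_eq_of_ne (fun e => hkj (Fin.succ_injective _ e).symm)) ?_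
    have hjk' : j.succ ∉ (Finsupp.single k.succ 1).support := by
      rw [Finsupp.mem_support_iff, not_not]
      exact Finsupp.single_eq_of_ne (fun e => hkj (Fin.succ_injective _ e).symm)
    rw [coeff_add, coeff_sub, coeff_mul_X', if_neg hjk', coeff_C_mul, coeff_X, if_pos rfl, coeff_C,
      if_neg (Finsupp.single_ne_zero.mpr one_ne_zero).symm, mul_one, zero_sub, neg_neg, add_zero]
    exact hh

end Members

end ChartDictionary

end Summit.ResolutionOfSingularities.ResolutionOfSingularities.Theorems.PIDim4

end
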